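import Summits.BirchSwinnertonDyer.BirchSwinnertonDyer.Theorems.ByReductionTypeAtTwoSupersingularFlatBlindTwistCurveSide
import Summits.BirchSwinnertonDyer.Rank1Residual.X11b.BDPRouteRankOneBookkeeping
import Literature.NumberTheory.EllipticCurves.PadicFormalLogOrder
import Literature.NumberTheory.EllipticCurves.MordellWeilProofs
import HarnessLib

/-!
# Route `ByReductionTypeAtTwo` (rung K4), crux `SupersingularRankZeroAtTwo` (item stmt-BirchSwinnertonDyer-19097), line
# `odd_blind_package` slot 5 (CDC_H): binder (B5) of the glue ★★ p814705 — **the rank-one INDEX BOOKKEEPING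
# `v₂ λ(P_ι) − v₂ [W₂(ℚ) : ℤP] = v₂ λ(P₁)`** (cell `bsd-2adic`, LEAD ss-1 GEN 21; memo `HOME/ss/gen21/HAND-TARGETS-CDC-3.md`)

HONEST FRAMING: THEOREMS ONLY (no definition, no named fact, no `sorry`, no instance); a helper (`--supports stmt-BirchSwinnertonDyer-19097`).
§1 is a generic rank-one bookkeeping lemma (any number field `K`, any prime `p`, any torsion-killing additive `g : E(K) → ℤ_p`):
`ord_p g(P) − ord_p [E(K) : ℤP] = ord_p g(P₁)` for `P` of infinite order and `P₁` a generator modulo torsion, when `E(K)[p] = 0`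
(`[E(K):ℤP]_p = |a|_p` for `P = a·P₁ + t`, tree `RankOne.padicValNat_index_zmultiples_eq`). §2 discharges binder `hB5` of
`OddBlindLocal.flatBlindControlCardHondaAtTwo_of` (type VERBATIM) from §1 at `K = ℚ`, `E = W₂`, `g = λ ∘ (· ⊗ ℚ₂)`, using `W₂(ℚ)[2] = 0` (★ p814209) and
`P_ι = P ⊗ ℚ₂` (uniqueness of `ℚ → ℚ₂`). It does NOT prove CDC_H (binders B1/B2/B3 remain); nothing booked; BSD is proved for no curve. bears_on: K4 (19097).

References: [JetchevSkinnerWan2017] Prop. 3.2.1, (7.1.5) (the index `[E(K):ℤP]_p`); [SilvermanAEC2009] VIII.6.7, VII.3.1; [Castella2018] §2.2.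
-/

set_option autoImplicit false
set_option linter.dupNamespace false

noncomputable section

open scoped Classical NumberField

namespace Summit.BirchSwinnertonDyer.BirchSwinnertonDyer.Theorems

namespace OddBlindLocal

open NumberField IsDedekindDomain WeierstrassCurve Literature.NumberTheory.EllipticCurves
  Literature.NumberTheory.EllipticCurves.Rank1Residual Summit.BirchSwinnertonDyer.Rank1Residual.X11b

/-! ## §1 Generic rank-one bookkeeping -/

/-- **`ord_p g(P) − ord_p [E(K) : ℤP] = ord_p g(P₁)`** for an elliptic curve `E` over a number field `K` of rank one with `E(K)[p] = 0`, an additive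
`g : E(K) → ℤ_p` vanishing exactly on torsion, a generator `P₁` modulo torsion and `P` of infinite order: writing `P = a·P₁ + t` (`t` torsion),
`g(P) = a·g(P₁)` and `ord_p [E(K) : ℤP] = ord_p |a|` (with a rank-one coordinate `c`, `c(P) = a·c(P₁)`, `|c(P₁)| = 1`;
`RankOne.padicValNat_index_zmultiples_eq`). [cite: JetchevSkinnerWan2017, Prop. 3.2.1 and (7.1.5) (arXiv:1512.06894 pp. 10, 16)]
[cite: SilvermanAEC2009, Thm. VIII.6.7] -/
theorem valuation_sub_padicValNat_index_eq_generic {K : Type} [Field K] [NumberField K] (E : WeierstrassCurve K) [E.IsElliptic]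
    (p : ℕ) [Fact p.Prime] (hr : E.mordellWeilRank = 1) (hiv : ∀ x : E.toAffine.Point, p • x = 0 → x = 0)
    (g : E.toAffine.Point → ℤ_[p]) (hg_add : ∀ x y, g (x + y) = g x + g y) (hg : ∀ x, g x = 0 ↔ IsOfFinAddOrder x)
    (P₁ : E.toAffine.Point) (hgen : ∀ P : E.toAffine.Point, ∃ (a : ℤ) (t : E.toAffine.Point), IsOfFinAddOrder t ∧ P = a • P₁ + t)
    (P : E.toAffine.Point) (hP : ¬ IsOfFinAddOrder P) :
    ((g P : ℤ_[p]) : ℚ_[p]).valuation - (padicValNat p (AddSubgroup.zmultiples P).index : ℤ) = ((g P₁).valuation : ℤ) := by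
  haveI : Finite (AddCommGroup.torsion E.toAffine.Point) := finite_torsion_point (W := E)
  let G : E.toAffine.Point →+ ℤ_[p] := AddMonoidHom.mk' g hg_add
  have hG : ∀ x, G x = g x := fun _ ↦ rfl
  -- the decomposition `P = a·P₁ + t`
  obtain ⟨a, t, ht, hPat⟩ := hgen P
  have hgt : g t = 0 := (hg t).mpr ht
  have hgP : g P = a • g P₁ := by
    rw [← hG, hPat, map_add, map_zsmul, hG, hG, hgt, add_zero]
  -- `P₁` of infinite order and `a ≠ 0`
  have hP₁ : ¬ IsOfFinAddOrder P₁ := fun h ↦ hP (by rw [hPat]; exact (h.zsmul).add ht)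
  have hx : g P₁ ≠ 0 := fun h ↦ hP₁ ((hg _).mp h)
  have ha : a ≠ 0 := fun h ↦ hP (by rw [hPat, h, zero_smul, zero_add]; exact ht)
  -- a rank-one coordinate: `c(P) = a · c(P₁)`, `|c(P₁)| = 1`
  obtain ⟨c, Q, hQ, hker⟩ := RankOne.exists_coord_of_mordellWeilRank_eq_one E hr
  have hcP₁ : (c P₁).natAbs = 1 := by
    obtain ⟨b, s, hs, hQbs⟩ := hgen Q
    have h1 : c P₁ * b = 1 := by
      have h := congrArg c hQbs
      rw [hQ, map_add, map_zsmul, RankOne.coord_eq_zero_of_isOfFinAddOrder c hs, add_zero, smul_eq_mul] at h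
      rw [mul_comm]; exact h.symm
    rcases Int.eq_one_or_neg_one_of_mul_eq_one h1 with h | h <;> simp [h]
  have hcP : c P = a * c P₁ := by
    have h := congrArg c hPat
    rw [map_add, map_zsmul, RankOne.coord_eq_zero_of_isOfFinAddOrder c ht, add_zero, smul_eq_mul] at h
    exact h
  have hcP0 : c P ≠ 0 := by
    rw [hcP]; exact mul_ne_zero ha (fun h ↦ by rw [h, Int.natAbs_zero] at hcP₁; exact zero_ne_one hcP₁)
  have hidx : padicValNat p (AddSubgroup.zmultiples P).index = padicValNat p a.natAbs := by
    rw [RankOne.padicValNat_index_zmultiples_eq c Q hQ hker hiv P hcP0, hcP, Int.natAbs_mul, hcP₁, mul_one]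
  -- assemble: `ord_p (a · x) = ord_p a + ord_p x`
  rw [hidx, hgP]
  have hx' : ((g P₁ : ℤ_[p]) : ℚ_[p]) ≠ 0 := PadicInt.coe_ne_zero.mpr hx
  have ha' : ((a : ℤ) : ℚ_[p]) ≠ 0 := by exact_mod_cast ha
  rw [zsmul_eq_mul, PadicInt.coe_mul, show (((a : ℤ) : ℤ_[p]) : ℚ_[p]) = ((a : ℤ) : ℚ_[p]) by norm_cast,
    Padic.valuation_mul ha' hx', PadicInt.valuation_coe, Padic.valuation_intCast]
  simp only [padicValInt]
  ring


/-! ## §2 Binder (B5) of the CDC_H glue -/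

/-- ★ **(B5) THE RANK-ONE INDEX BOOKKEEPING** — binder `hB5` of `flatBlindControlCardHondaAtTwo_of` (★★ p814705), type VERBATIM:
`ord₂ λ(P_ι) − ord₂ [W₂(ℚ) : ℤP] = ord₂ λ(P₁ ⊗ ℚ₂)` for `λ` vanishing exactly on torsion, `P₁` a generator modulo torsion and `P` of infinite order
(`P ∈ (W₂ ⊗ ℚ)(ℚ)`, the currency of `padicLogOrd`). §1 at `K = ℚ`, `E = W₂ ⊗ ℚ`, `g = λ ∘ (· ⊗ ℚ₂)`; `W₂(ℚ)[2] = 0` by ★ p814209 and the injective base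
change; `P_ι = P ⊗ ℚ₂` by the uniqueness of `ℚ → ℚ₂`. (The generic lemma is elaborated with the classical `DecidableEq`; over `ℚ` the instance
`instDecidableEqRat` is found — `convert` bridges the subsingleton instance gap, as in `X12.O11.StrictSelmerIndexModTorsionRat`.)
[cite: JetchevSkinnerWan2017, Prop. 3.2.1 and (7.1.5) (arXiv:1512.06894 pp. 10, 16)] [cite: SilvermanAEC2009, Thm. VIII.6.7 and VII.3.1] -/
theorem valuation_sub_padicValNat_index_eq_of_generator :
    ∀ (W : WeierstrassCurve ℚ) [W.IsElliptic] [W.IsGloballyMinimal], GoodSS W 2 →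
      ∀ (W₂ : WeierstrassCurve ℚ) [W₂.IsElliptic] [W₂.IsGloballyMinimal],
        (∃ C : WeierstrassCurve.VariableChange ℚ, C • W.quadraticTwist 2 = W₂) → W₂.mordellWeilRank = 1 →
      ∀ (lam : (W₂.baseChange ℚ_[2]).toAffine.Point →+ ℤ_[2]), (∀ X, lam X = 0 ↔ IsOfFinAddOrder X) →
      ∀ (P₁ : W₂.toAffine.Point), (∀ P : W₂.toAffine.Point, ∃ (a : ℤ) (t : W₂.toAffine.Point), IsOfFinAddOrder t ∧ P = a • P₁ + t) →
      ∀ (ι : ℚ →+* ℚ_[2]) (P : (W₂.baseChange ℚ).toAffine.Point), ¬ IsOfFinAddOrder P →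
        (((lam (Literature.NumberTheory.EllipticCurves.padicPointOf W₂ 2 ι P) : ℤ_[2]) : ℚ_[2]).valuation -
            (padicValNat 2 (AddSubgroup.zmultiples P).index : ℤ)) =
          ((lam (Affine.Point.baseChange (W' := W₂) ℚ ℚ_[2] P₁)).valuation : ℤ) := by
  intro W _ _ hss W₂ _ _ htw hr lam hlam P₁ hgen ι P hP
  haveI : Fact (Nat.Prime 2) := ⟨Nat.prime_two⟩
  haveI hE : (W₂.baseChange ℚ).IsElliptic := by rw [WeierstrassCurve.baseChange]; infer_instance
  have hinj := WeierstrassCurve.Affine.Point.map_injective (W' := W₂.toAffine) (f := Algebra.ofId ℚ ℚ_[2])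
  -- no `2`-torsion in `(W₂ ⊗ ℚ)(ℚ)`
  have hiv : ∀ x : (W₂.baseChange ℚ).toAffine.Point, 2 • x = 0 → x = 0 := fun x hx ↦ by
    apply hinj
    rw [map_zero]
    refine forall_two_nsmul_eq_zero_padic_twist_of_goodSS W hss W₂ htw _ ?_
    rw [← map_nsmul, hx, map_zero]
  -- `g = λ ∘ (· ⊗ ℚ₂)` vanishes exactly on torsion
  have hg : ∀ x : (W₂.baseChange ℚ).toAffine.Point,
      lam (Affine.Point.baseChange (W' := W₂) ℚ ℚ_[2] x) = 0 ↔ IsOfFinAddOrder x := fun x ↦ by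
    rw [hlam]
    constructor
    · intro h
      obtain ⟨n, hn, hnx⟩ := (isOfFinAddOrder_iff_nsmul_eq_zero).mp h
      refine (isOfFinAddOrder_iff_nsmul_eq_zero).mpr ⟨n, hn, hinj ?_⟩
      rw [map_nsmul, map_zero]
      exact hnx
    · exact AddMonoidHom.isOfFinAddOrder _
  -- `P_ι = P ⊗ ℚ₂`
  have hPι : Literature.NumberTheory.EllipticCurves.padicPointOf W₂ 2 ι P =
      Affine.Point.baseChange (W' := W₂) ℚ ℚ_[2] P := by
    have hι : ι.toRatAlgHom = Algebra.ofId ℚ ℚ_[2] := Subsingleton.elim _ _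
    exact congrArg (fun f : ℚ →ₐ[ℚ] ℚ_[2] ↦ Affine.Point.map (W' := W₂.toAffine) f P) hι
  rw [hPι]
  -- §1 (classical `DecidableEq ℚ` inside; `convert` bridges the subsingleton instance gap)
  have key := valuation_sub_padicValNat_index_eq_generic (K := ℚ) (W₂.baseChange ℚ) 2 (by
      have hWW : W₂.baseChange ℚ = W₂ := by
        rw [WeierstrassCurve.baseChange, Algebra.algebraMap_self, WeierstrassCurve.map_id]
      convert hr)
    (fun x hx ↦ hiv x (by convert hx))
    (fun x ↦ lam (Affine.Point.baseChange (W' := W₂) ℚ ℚ_[2] x))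
    (fun x y ↦ by
      rw [← map_add lam]
      congr 1
      convert map_add (Affine.Point.baseChange (W' := W₂) ℚ ℚ_[2]) x y)
    (fun x ↦ by convert hg x)
    P₁ (fun Q ↦ by
      obtain ⟨a, t, ht, h⟩ := hgen Q
      exact ⟨a, t, by convert ht <;> rfl, by convert h <;> rfl⟩)
    P (fun h ↦ hP (by convert h))
  convert key

end OddBlindLocal

end Summit.BirchSwinnertonDyer.BirchSwinnertonDyer.Theorems

end
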